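import Summits.ResolutionOfSingularities.ResolutionOfSingularities.Theorems.RadicialJungCleanModelsRegularTypeDerivations
import Summits.ResolutionOfSingularities.ResolutionOfSingularities.Theorems.RadicialJungCleanModelsStubFormalFibreReducedStalk
import Literature.AlgebraicGeometry.Resolution.RegularFormallySmoothPrimeField
import Literature.AlgebraicGeometry.Resolution.StrictNormalCrossingsAt
import Literature.AlgebraicGeometry.Resolution.ResolutionOfSingularities
import HarnessLib

/-!
# Regular type ⟺ a logarithmic derivation with unit value: stalks of regular schemes over any field

Route `ResolutionOfSingularities/RadicialJung`, crux `CleanModels` (stmt-ResolutionOfSingularities-15917),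
line `via-clean-models` of crux `DescentPerfectToAll` (stmt-ResolutionOfSingularities-0549). Helper
file (`--supports`), OURS; nothing here is a statement of Hironaka's manuscript.

Companion of `RadicialJungCleanModelsRegularTypeDerivations.lean`, which proves — for local rings
formally smooth over the prime field `𝔽_p` — that the crux's derivation-free "regular type"
(`IsWoundOrTransversalAt p x u`: `u - c^p ∉ 𝔪` for all `c`, or `u - c^p ∈ 𝔪 ∖ (𝔪² + (x))` for some
`c`) is EQUIVALENT to Giraud's differential condition (Giraud 1983, Prop. 1.5 (ii) (c-2): a
logarithmic derivation `D`, `x_j ∣ D x_j`, with `D u` a unit). This file puts the equivalence in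
the form in which the crux consumes it: along a sub-family of a REGULAR SYSTEM OF PARAMETERS
`t : Fin d → 𝔪`, `(t) = 𝔪`, `d = dim O` (the crux's toroidal/regular-type data) of a regular local
ring essentially of finite type over an ARBITRARY field `k` of characteristic `p` — formally smooth
over `𝔽_p` by the tree's `formallySmooth_zmod_of_isRegularLocalRing_of_essFiniteType` (Stacks 031I
over the prime field; no `F`-finiteness, no separability of residue fields) — and at the STALKS of
a regular scheme locally of finite type over `k`:

* `isWoundOrTransversalAt_iff_exists_logDerivation_of_rsop` — ring form;
* `isWoundOrTransversalAt_stalk_iff_exists_logDerivation_of_rsop` — at a point `v` of a regular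
  `k`-scheme locally of finite type, along a sub-family of a regular system of parameters of
  `𝒪_{V,v}`;
* `regularType_stalk_iff_exists_derivation_isUnit` — boundary-free, at a stalk: the crux's regular
  type of `u ∈ 𝒪_{V,v}` iff some derivation of `𝒪_{V,v}` has `D u` a unit.

## References
* J. Giraud, *Forme normale d'une fonction sur une surface de caractéristique positive*, Bull. Soc.
  Math. France 111 (1983) 109–124: Prop. 1.5. [Giraud1983]
* H. Matsumura, *Commutative Ring Theory* (1986), Thm. 14.2, Thm. 25.2, Thm. 30.6. [Matsumura1987]
* The Stacks Project, Tag 031I. [StacksProject]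
-/

noncomputable section

set_option linter.dupNamespace false -- mandated namespace of this single-conjunct summit

open IsLocalRing Module AlgebraicGeometry
open Literature.AlgebraicGeometry.Resolution

namespace Summit.ResolutionOfSingularities.ResolutionOfSingularities.Theorems.RadicialJung.CleanModels

universe u

/-! ## Along a regular system of parameters -/

/-- With a regular system of parameters: for `t : Fin d → O` generating `𝔪` with `d = dim O`
(`O` regular local, essentially of finite type over a field `k` of characteristic `p` — ANY `k`),
any sub-family `x = t ∘ σ` (`σ` injective) and any `u`: `IsWoundOrTransversalAt p (t ∘ σ) u` iff
some derivation `D` with `x_j ∣ D x_j` has `D u` a unit. The members of a regular system of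
parameters are independent in `𝔪/𝔪²` (Matsumura Thm. 14.2, `mem_maximalIdeal_of_sum_mul_rsop_mem_sq`)
and `O` is formally smooth over `𝔽_p` (`formallySmooth_zmod_of_isRegularLocalRing_of_essFiniteType`),
so `isWoundOrTransversalAt_iff_exists_logDerivation` applies. [cite: Giraud1983, Prop. 1.5 (ii)]
[cite: Matsumura1987, Thm. 14.2] -/
theorem isWoundOrTransversalAt_iff_exists_logDerivation_of_rsop (p : ℕ) [Fact p.Prime]
    (k : Type u) [Field k] [CharP k p] (O : Type u) [CommRing O] [Algebra k O]
    [Algebra.EssFiniteType k O] [IsRegularLocalRing O] {d r : ℕ} (t : Fin d → O)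
    (ht : Ideal.span (Set.range t) = maximalIdeal O) (hd : ringKrullDim O = (d : WithBot ℕ∞))
    (σ : Fin r → Fin d) (hσ : Function.Injective σ) (u : O) :
    IsWoundOrTransversalAt p (t ∘ σ) u ↔
      ∃ D : Derivation ℤ O O, (∀ j, t (σ j) ∣ D (t (σ j))) ∧ IsUnit (D u) := by
  haveI : CharP O p := charP_of_injective_algebraMap (algebraMap k O).injective p
  letI : Algebra (ZMod p) O := ZMod.algebra O p
  haveI := formallySmooth_zmod_of_isRegularLocalRing_of_essFiniteType p k O
  have htm : ∀ i, t i ∈ maximalIdeal O := fun i => ht ▸ Ideal.subset_span ⟨i, rfl⟩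
  have hfin : (maximalIdeal O).spanFinrank = d := by
    have h := IsRegularLocalRing.spanFinrank_maximalIdeal (R := O)
    rw [hd] at h
    exact_mod_cast h
  have hli : LinearIndependent (ResidueField O)
      fun i => (maximalIdeal O).toCotangent ⟨t i, htm i⟩ := by
    rw [linearIndependent_toCotangent_iff_forall_mem]
    exact fun c hc i => mem_maximalIdeal_of_sum_mul_rsop_mem_sq hfin t ht c hc i
  exact isWoundOrTransversalAt_iff_exists_logDerivation p (x := t ∘ σ) (fun j => htm (σ j))
    (hli.comp σ hσ) u

/-! ## At the stalks of a regular scheme locally of finite type over a field -/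

/-- **Stalk form, along a regular system of parameters.** For `V` regular and locally of finite
type over a field `k` of characteristic `p` (ANY `k`), a point `v`, a regular system of parameters
`t : Fin d → 𝒪_{V,v}` (`(t) = 𝔪_v`, `d = dim 𝒪_{V,v}`), a sub-family `t ∘ σ` (`σ` injective) and
`u ∈ 𝒪_{V,v}`: `IsWoundOrTransversalAt p (t ∘ σ) u` iff some derivation `D` of `𝒪_{V,v}` with
`t_{σ j} ∣ D t_{σ j}` has `D u` a unit (`𝒪_{V,v}` is essentially of finite type over `k`,
`exists_algebra_essFiniteType_stalk`). [cite: Giraud1983, Prop. 1.5 (ii)] -/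
theorem isWoundOrTransversalAt_stalk_iff_exists_logDerivation_of_rsop (p : ℕ) [Fact p.Prime]
    (k : Type) [Field k] [CharP k p] (V : Scheme.{0}) (f : V ⟶ Spec (.of k))
    [LocallyOfFiniteType f] (hV : Scheme.IsRegular V) (v : V) {d r : ℕ}
    (t : Fin d → V.presheaf.stalk v)
    (ht : Ideal.span (Set.range t) = maximalIdeal (V.presheaf.stalk v))
    (hd : ringKrullDim (V.presheaf.stalk v) = (d : WithBot ℕ∞))
    (σ : Fin r → Fin d) (hσ : Function.Injective σ) (u : V.presheaf.stalk v) :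
    IsWoundOrTransversalAt p (t ∘ σ) u ↔
      ∃ D : Derivation ℤ (V.presheaf.stalk v) (V.presheaf.stalk v),
        (∀ j, t (σ j) ∣ D (t (σ j))) ∧ IsUnit (D u) := by
  obtain ⟨_, _⟩ := exists_algebra_essFiniteType_stalk k V f v
  haveI : IsRegularLocalRing (V.presheaf.stalk v) := hV v
  exact isWoundOrTransversalAt_iff_exists_logDerivation_of_rsop p k (V.presheaf.stalk v) t ht hd
    σ hσ u

/-- **Stalk form, boundary-free.** For `V` regular and locally of finite type over a field `k` of
characteristic `p` (ANY `k`), a point `v` and `u ∈ 𝒪_{V,v}`: the crux's regular type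
«`u - c^p ∉ 𝔪_v` for all `c`, or `u - c^p ∈ 𝔪_v ∖ 𝔪_v²` for some `c`» holds iff some derivation
`D` of `𝒪_{V,v}` has `D u` a unit. [cite: Giraud1983, Prop. 1.5] -/
theorem regularType_stalk_iff_exists_derivation_isUnit (p : ℕ) [Fact p.Prime]
    (k : Type) [Field k] [CharP k p] (V : Scheme.{0}) (f : V ⟶ Spec (.of k))
    [LocallyOfFiniteType f] (hV : Scheme.IsRegular V) (v : V) (u : V.presheaf.stalk v) :
    ((∀ c : V.presheaf.stalk v, u - c ^ p ∉ maximalIdeal (V.presheaf.stalk v)) ∨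
      (∃ c : V.presheaf.stalk v, u - c ^ p ∈ maximalIdeal (V.presheaf.stalk v) ∧
        u - c ^ p ∉ maximalIdeal (V.presheaf.stalk v) ^ 2)) ↔
      ∃ D : Derivation ℤ (V.presheaf.stalk v) (V.presheaf.stalk v), IsUnit (D u) := by
  obtain ⟨_, _⟩ := exists_algebra_essFiniteType_stalk k V f v
  haveI : IsRegularLocalRing (V.presheaf.stalk v) := hV v
  haveI : CharP (V.presheaf.stalk v) p :=
    charP_of_injective_algebraMap (algebraMap k (V.presheaf.stalk v)).injective p
  letI : Algebra (ZMod p) (V.presheaf.stalk v) := ZMod.algebra (V.presheaf.stalk v) p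
  haveI := formallySmooth_zmod_of_isRegularLocalRing_of_essFiniteType p k (V.presheaf.stalk v)
  exact regularType_iff_exists_derivation_isUnit p u

/-- **Stalk form of Giraud's `E(f)` criterion.** For `V` regular and locally of finite type over a
field `k` of characteristic `p`, a point `v` and `u ∈ 𝒪_{V,v}`: every derivation of `𝒪_{V,v}`
maps `u` into `𝔪_v` iff `u = g^p + h` with `h ∈ 𝔪_v²` — the point `v` lies in Giraud's `E(u)`
(Déf. 1.2) iff `u ∈ 𝒪_{V,v}^p + 𝔪_v²`. [cite: Giraud1983, Déf. 1.2] -/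
theorem forall_derivation_stalk_apply_mem_iff (p : ℕ) [Fact p.Prime]
    (k : Type) [Field k] [CharP k p] (V : Scheme.{0}) (f : V ⟶ Spec (.of k))
    [LocallyOfFiniteType f] (hV : Scheme.IsRegular V) (v : V) (u : V.presheaf.stalk v) :
    (∀ D : Derivation ℤ (V.presheaf.stalk v) (V.presheaf.stalk v),
        D u ∈ maximalIdeal (V.presheaf.stalk v)) ↔
      ∃ g h : V.presheaf.stalk v, h ∈ maximalIdeal (V.presheaf.stalk v) ^ 2 ∧ u = g ^ p + h := by
  obtain ⟨_, _⟩ := exists_algebra_essFiniteType_stalk k V f v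
  haveI : IsRegularLocalRing (V.presheaf.stalk v) := hV v
  haveI : CharP (V.presheaf.stalk v) p :=
    charP_of_injective_algebraMap (algebraMap k (V.presheaf.stalk v)).injective p
  letI : Algebra (ZMod p) (V.presheaf.stalk v) := ZMod.algebra (V.presheaf.stalk v) p
  haveI := formallySmooth_zmod_of_isRegularLocalRing_of_essFiniteType p k (V.presheaf.stalk v)
  rw [forall_derivation_apply_mem_iff_exists_sub_pow_mem_sq p u]
  constructor
  · rintro ⟨g, hg⟩
    exact ⟨g, u - g ^ p, hg, (add_sub_cancel _ _).symm⟩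
  · rintro ⟨g, h, hh, rfl⟩
    exact ⟨g, by rwa [add_sub_cancel_left]⟩

end Summit.ResolutionOfSingularities.ResolutionOfSingularities.Theorems.RadicialJung.CleanModels

end
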